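import Summits.ValiantsHypothesis.ValiantsHypothesis.Theorems.KPlusLogSqLawTropicalBTopHeavyCoreLexDeficiency
import Summits.ValiantsHypothesis.ValiantsHypothesis.Theorems.KPlusLogSqLawTropicalBTopHeavyCoreMirror

/-!
# Route «KPlusLogSqLaw», crux `TropicalB` (stmt-ValiantsHypothesis-19771) — DEFICIENCY GROWTH, `DesignRowD` FORM AND ITS MIRROR:
# top-heavy cells and bottom-light cells both miss at least `min(m − 1, #heavy/light classes)` histograms

HONEST FRAMING.  Census bookkeeping (cell `pub-symmetroid`, seat val-sym-trop-p1 g23, 2026-08-29; `--supports stmt-ValiantsHypothesis-19771 --as helper`)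
over this seat's `topHeavy_deficiency` (…TopHeavyCoreLexDeficiency, p674510) and the class-reversal duality of the unsigned row
(`ClassReversal.designRowD_of_classRev`, val-sym-trop-p5 g12; used exactly as in g21's …TopHeavyCoreMirror).  Finite-format statements about the
UNSIGNED census (`DesignRowD`, …TropicalBSplitDefs); calibration data of the census, NOT bounds of `TropicalB` shape; nothing here bears on `TropicalB`
in its window, `WeakLifting`, DoorA26 / DoorA34, `MatrixDescartes` (stmt-ValiantsHypothesis-18050) or VP ≠ VNP.

* `designRowD_topHeavy_deficiency` — `d c₀ < d c₁ < d c₂ < d c₃`, `d c₀` minimal, `T` = classes `l` with `d c₃ + (m−1)·d c₂ < d l + (m−1)·d c₀`: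
  unsigned row `≤ multichoose K m − 1 − min(m−1, #T)` (for `m ≥ 2`).
* `designRowD_bottomLight_deficiency` — MIRROR: `d a₁ < d a₂ < d a₃ < d a₄`, `d a₄` maximal, `T` = LIGHT classes `l` with
  `(m−1)·d a₄ + d l < d a₁ + (m−1)·d a₂`: unsigned row `≤ multichoose K m − 1 − min(m−1, #T)`.  (g21's mirror census
  `designRowD_core_mirror` is ONE miss; here the deficiency grows with the number of light classes — e.g. several isolated small exponents far below
  a cluster of four.)
[this cell]
-/

set_option linter.dupNamespace false
set_option autoImplicit false

namespace Summit.ValiantsHypothesis.ValiantsHypothesis.Theorems.KPlusLogSqLaw.TopHeavyCore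

open Summit.ValiantsHypothesis.ValiantsHypothesis.Theorems.MatrixDescartes.Negative
open Finset

variable {m K : ℕ}

/-- **TOP-HEAVY DEFICIENCY, `DesignRowD` form.** [this cell] -/
theorem designRowD_topHeavy_deficiency (hm : 2 ≤ m) (d : Fin K → ℕ) (v ε : Fin m → Fin m → Fin K → ℤ) (c₀ c₁ c₂ c₃ : Fin K)
    (hmin : ∀ l, d c₀ ≤ d l) (h01 : d c₀ < d c₁) (h12 : d c₁ < d c₂) (h23 : d c₂ < d c₃) (T : Finset (Fin K))
    (hTop : ∀ l ∈ T, (d c₃ : ℤ) + ((m : ℤ) - 1) * d c₂ < d l + ((m : ℤ) - 1) * d c₀) :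
    DesignRowD d v ε (Nat.multichoose K m - 1 - min (m - 1) T.card) := by
  intro n θ p hθ hdom hne
  have h := topHeavy_deficiency hm d v ε c₀ c₁ c₂ c₃ hmin h01 h12 h23 T hTop θ p hθ hdom hne
  omega

/-- **BOTTOM-LIGHT DEFICIENCY (mirror).**  `d a₁ < d a₂ < d a₃ < d a₄` with `d a₄` maximal; `T` a set of light classes `l` with
`(m−1)·d a₄ + d l < d a₁ + (m−1)·d a₂`.  Then the unsigned row is `≤ multichoose K m − 1 − min(m−1, #T)`. [this cell] -/
theorem designRowD_bottomLight_deficiency (hm : 2 ≤ m) (d : Fin K → ℕ) (v ε : Fin m → Fin m → Fin K → ℤ) (a₁ a₂ a₃ a₄ : Fin K)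
    (hmax : ∀ l, d l ≤ d a₄) (h12 : d a₁ < d a₂) (h23 : d a₂ < d a₃) (h34 : d a₃ < d a₄) (T : Finset (Fin K))
    (hLight : ∀ l ∈ T, ((m : ℤ) - 1) * d a₄ + d l < d a₁ + ((m : ℤ) - 1) * d a₂) :
    DesignRowD d v ε (Nat.multichoose K m - 1 - min (m - 1) T.card) := by
  classical
  refine ClassReversal.designRowD_of_classRev d (d a₄) v ε hmax _ ?_
  have h1 := hmax a₁; have h2 := hmax a₂; have h3 := hmax a₃
  have hcard : (T.image Fin.rev).card = T.card := card_image_of_injective _ Fin.rev_injective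
  rw [← hcard]
  refine designRowD_topHeavy_deficiency hm _ _ _ (Fin.rev a₄) (Fin.rev a₃) (Fin.rev a₂) (Fin.rev a₁) ?_ ?_ ?_ ?_ (T.image Fin.rev) ?_
  · intro l; simp only [Fin.rev_rev]; omega
  · simp only [Fin.rev_rev]; omega
  · simp only [Fin.rev_rev]; omega
  · simp only [Fin.rev_rev]; omega
  · intro l' hl'
    obtain ⟨l, hl, rfl⟩ := mem_image.mp hl'
    have h0 := hmax l
    have hz := hLight l hl
    have hmz : (2 : ℤ) ≤ m := by exact_mod_cast hm
    simp only [Fin.rev_rev]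
    push_cast [Nat.cast_sub h0, Nat.cast_sub h1, Nat.cast_sub h2, Nat.cast_sub h3, Nat.sub_self]
    nlinarith

end Summit.ValiantsHypothesis.ValiantsHypothesis.Theorems.KPlusLogSqLaw.TopHeavyCore
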